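import Summits.QuantumFields.BalabanUV.T4Continuum.Support.NE7ConvOneStepUnique
import HarnessLib

/-!
# NE7ConvOneStepCriticalUnique — AT MOST ONE CRITICAL ORBIT, IN THE DICTIONARY (the critical-point half of [Balaban1985Variational] Prop. 7):
# two configurations that are each CRITICAL on a Poincaré slice, one REPRESENTED over the other with the normal letters, coincide — by the
# slope inequality `φ′(1) − φ′(0) ≥ c` along the segment with a slop at BOTH ends and the strict numeric line

Cell `pub-balaban`, rung (B)+1 sub-cell t4, lineage `b2b-balaban-t4-ne7-p1`, generation 66 (CRUX PROVER NE7 #1); hunt (h10) «ONE-STEP = CRIT ∧ CONV»,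
memo `t4/b2b-balaban-t4-ne7-p1-g66/HUNT-H10-TWO-ROADS.md` §2.  File F7 (over F6 `NE7ConvOneStepUnique` p349424 and F1–F3).

WHAT ([folklore]; 0 def, 0 sorry).  F6 settled the MINIMISER half of Prop. 7 («a second minimiser represented over the critical `U♯` is `U♯`») from
`φ(1) ≤ φ(0)`.  For two CRITICAL configurations no action comparison is available; instead the right end carries its own slop:
§1 **`abs_dAction_le_of_tangent_critical`** — at a unitary `U` with `SmallField U a`, a split `X = X_T + X_N` with `dAction U X_T W = 0` and the normal
   letter `Σ_W‖d_U X_N‖ ≤ C_N·D`: `|dAction U X W| ≤ a·C_N·D` (both signs; F3 gave the lower one);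
§2 **`dirSq_eq_zero_of_two_slops`** — `c ≤ hess (U e^{tX}) X X W` on `[0,1]` with `c = c_X·D`, `−κ₀·D ≤ dAction U X W`, `dAction (U e^{X}) X W ≤ κ₁·D`,
   `κ₀ + κ₁ < c_X`, `D ≥ 0` ⟹ `D = 0` (`T4ConvexResponse.slope_lower`: `c ≤ φ′(1) − φ′(0)`; `φ′(1) = dAction (U e^{X}) X` by `NE3HessForm`);
§3 **`vary_eq_self_of_two_critical`** — `U♯` unitary, `SmallField U♯ a`, critical on a Poincaré slice `T` (`SlicePoincare L k U♯ T C`); `X` skew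
   `(N·L^k)`-periodic, `‖X‖_∞ ≤ α`, `SmallField (U♯e^{X}) a`, LEFT split `X = X_T + X_N` (`X_T ∈ T`, letters `θ`, `C_N`), and the second configuration
   `U′ = U♯e^{X}` CRITICAL on a set `T′` containing the tangent part of a RIGHT split `X = X′_T + X′_N` with letter `C′_N`; strict line
   `2a(C_N + C′_N) < 2·c_X`, i.e. `a·C_N + a·C′_N < c_X = (m∕2 − 576d(e^α−1)²)∕card n − 28d(a + 7α²)`, `m = (L^k)^{−2}∕(4C) − ((L^k)^{−2}∕(2C) + 16d)θ` ⟹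
   `X = 0` and `U♯e^{X} = U♯` — «at most one critical orbit» modulo REP (the gauge identity `u·U′ = U♯e^{X}` is the supplier's).
HONEST FRAMING (page 1): convexity bookkeeping over HYPOTHESES (REP with the normal letters at both ends, criticality of both configurations on their
slices, (P♮) at `U♯`); nothing is asserted about Bałaban's minimisers; NOT ONE-STEP, NOT NE7; spine 0∕9; finite T⁴ rung (B)+1 — NOT infinite volume,
NOT mass gap, NOT Clay.  Continuum YM on T⁴ ⇐ BetaPertH ∧ nine spine estimates (0/9 proved); BetaPertH ⇐ (D1) ∧ (D4) ∧ CAP+tail; G-an2-4 gates asym,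
D1 and NE2/3/4.
-/

set_option autoImplicit false

open scoped BigOperators Matrix.Norms.L2Operator
open NormedSpace Finset Set

namespace Summit.QuantumFields.BalabanUV.T4Continuum.NE7ConvOneStepCriticalUnique

open Literature.MathematicalPhysics.QuantumFieldTheory.Balaban1983to89
open B7Prop1Explicit B7Prop2Explicit MatrixLog UnitaryModel
open T4AveragingDeficitWall (IsUnitaryCfg IsSkewDir SmallField fineAction vary curl curlSq dirSq vary_zero vary_zero_dir)
open T4AveragingDeficitWallBoundary (IsPeriodicCfg periodBox)
open AveragingDeficitPeriodicCounting (IsPeriodicDir)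
open T4ConvexResponse (slope_lower)
open MinimalActionLevels (perWin)
open NE3HessForm (hess dAction segment_derivData vary_add)
open NE3HessShapes (plaqsOf)
open NE3SlicePoincareShape (SlicePoincare)
open NE7ExactCurrent (dAction_add)
open NE7OneStepOfCritical (hess_vary_ge_of_poincare)
open NE7SegmentPlaquetteRadius (smallField_vary_segment_class)
open NE7OneStepLetters (abs_dAction_le_radius_mul slop_of_tangent_critical curlSq_ge_of_slicePoincare)
open NE7ConvOneStepUnique (eq_zero_of_dirSq_eq_zero)

noncomputable section

variable {d : ℕ} {n : Type*} [Fintype n] [DecidableEq n]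

/-! ## §1 The two-sided slop from criticality on the tangent part -/

/-- **`|dAction U X W| ≤ a·C_N·D`** from a split `X = X_T + X_N` with `dAction U X_T W = 0` (criticality on the tangent part), the normal letter
`Σ_W‖(d_U X_N)(p)‖ ≤ C_N·D` and `SmallField U a`, `a ≥ 0`. [folklore] -/
theorem abs_dAction_le_of_tangent_critical [Nonempty n] {U : Site d → Fin d → (Matrix n n ℂ)ˣ} (hU : IsUnitaryCfg U) {a : ℝ} (ha : 0 ≤ a)
    (hUa : SmallField U a) {X XT XN : Site d → Fin d → Matrix n n ℂ} (hsplit : X = XT + XN) (hXN : IsSkewDir XN)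
    (W : Finset (T4AveragingDeficitWall.Plaq d)) (hcrit : dAction U XT W = 0) {CN D : ℝ} (hN1 : ∑ p ∈ W, ‖curl U XN p‖ ≤ CN * D) :
    |dAction U X W| ≤ a * CN * D := by
  rw [hsplit, dAction_add, hcrit, zero_add]
  refine (abs_dAction_le_radius_mul hU hXN hUa W).trans ?_
  rw [mul_assoc]
  exact mul_le_mul_of_nonneg_left hN1 ha

/-! ## §2 The slope inequality with a slop at both ends -/

/-- **`D = 0` FROM TWO SLOPS AND STRICT CONVEXITY**: `c_X·D ≤ hess (U e^{tX}) X X W` on `[0,1]`, `−κ₀·D ≤ dAction U X W`, `dAction (U e^{X}) X W ≤ κ₁·D`,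
`κ₀ + κ₁ < c_X`, `0 ≤ D` ⟹ `D = 0`. [folklore] -/
theorem dirSq_eq_zero_of_two_slops (V : Site d → Fin d → (Matrix n n ℂ)ˣ) (X : Site d → Fin d → Matrix n n ℂ)
    (W : Finset (T4AveragingDeficitWall.Plaq d)) {cX κ₀ κ₁ D : ℝ} (hD : 0 ≤ D) (hconv : ∀ t ∈ Icc (0 : ℝ) 1, cX * D ≤ hess (vary V X t) X X W)
    (hleft : -(κ₀ * D) ≤ dAction V X W) (hright : dAction (vary V X 1) X W ≤ κ₁ * D) (hline : κ₀ + κ₁ < cX) : D = 0 := by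
  obtain ⟨-, h2⟩ := segment_derivData V X W
  have h0 : (0 : ℝ) ∈ Icc (0 : ℝ) 1 := by simp
  have h1 : (1 : ℝ) ∈ Icc (0 : ℝ) 1 := by simp
  have key := slope_lower h2 hconv h0 h1 zero_le_one
  rw [vary_zero] at key
  -- key : cX * D * (1 - 0) ≤ dAction (vary V X 1) X W - dAction V X W
  have hk : (cX - κ₀ - κ₁) * D ≤ 0 := by nlinarith
  have hpos : 0 < cX - κ₀ - κ₁ := by linarith
  by_contra hne
  have hDpos : 0 < D := lt_of_le_of_ne hD (Ne.symm hne)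
  have := mul_pos hpos hDpos
  linarith

/-! ## §3 Two critical configurations, one represented over the other, coincide -/

/-- **AT MOST ONE CRITICAL ORBIT MODULO REP** (the critical-point half of [Balaban1985Variational] Prop. 7, in the dictionary).  See the module
docstring, §3 (`L, N ≥ 1`). [folklore] -/
theorem vary_eq_self_of_two_critical [Nonempty n] {L N k : ℕ} (hL : 1 ≤ L) (hN : 1 ≤ N) {Us : Site d → Fin d → (Matrix n n ℂ)ˣ}
    (hUs : IsUnitaryCfg Us) {a : ℝ} (ha : 0 ≤ a) (hUsa : SmallField Us a) {T T' : Set (Site d → Fin d → Matrix n n ℂ)} {C : ℝ} (hC : 0 < C)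
    (hP : SlicePoincare L k Us T C (periodBox (d := d) (N * L ^ k))) (hcrit : ∀ Y ∈ T, dAction Us Y (perWin d (N * L ^ k)) = 0)
    {X XT XN XT' XN' : Site d → Fin d → Matrix n n ℂ} {α θ CN CN' : ℝ} (hXs : IsSkewDir X) (hXP : IsPeriodicDir X ((N * L ^ k : ℕ) : ℤ))
    (hα : 0 ≤ α) (hXα : ∀ x μ, ‖X x μ‖ ≤ α) (h1 : SmallField (vary Us X 1) a)
    (hsplit : X = XT + XN) (hXT : XT ∈ T) (hXNs : IsSkewDir XN) (hXNP : IsPeriodicDir XN ((N * L ^ k : ℕ) : ℤ))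
    (hN2 : dirSq XN (periodBox (d := d) (N * L ^ k)) ≤ θ * dirSq X (periodBox (d := d) (N * L ^ k)))
    (hN1 : (∑ p ∈ perWin d (N * L ^ k), ‖curl Us XN p‖) ≤ CN * dirSq X (periodBox (d := d) (N * L ^ k)))
    (hcrit' : ∀ Y ∈ T', dAction (vary Us X 1) Y (perWin d (N * L ^ k)) = 0)
    (hsplit' : X = XT' + XN') (hXT' : XT' ∈ T') (hXN's : IsSkewDir XN')
    (hN1' : (∑ p ∈ perWin d (N * L ^ k), ‖curl (vary Us X 1) XN' p‖) ≤ CN' * dirSq X (periodBox (d := d) (N * L ^ k)))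
    (hline : a * CN + a * CN' < (((((((L : ℝ) ^ k)⁻¹) ^ 2 / C) / 4 - (((((L : ℝ) ^ k)⁻¹) ^ 2 / C) / 2 + 16 * d) * θ) / 2
        - 576 * d * (Real.exp α - 1) ^ 2) / (Fintype.card n : ℝ) - 28 * d * (a + 7 * α ^ 2))) :
    X = (fun _ _ => 0) ∧ vary Us X 1 = Us := by
  have hN0 : 0 < N := hN
  have hL0 : 0 < L := hL
  have hM : 0 < N * L ^ k := Nat.mul_pos hN0 (Nat.pow_pos hL0)
  have e : perWin d (N * L ^ k) = plaqsOf (periodBox (d := d) (N * L ^ k)) := rfl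
  set D := dirSq X (periodBox (d := d) (N * L ^ k)) with hDdef
  have hD : 0 ≤ D := by rw [hDdef]; unfold dirSq; positivity
  -- convexity along the segment from the left-end letters
  have hPX := curlSq_ge_of_slicePoincare hM hUs hC hP hsplit hXT hXNP hN2
  have hrad : ∀ t ∈ Icc (0 : ℝ) 1, SmallField (vary Us X t) (a + 7 * α ^ 2) := fun t ht => smallField_vary_segment_class hUs hXs hUsa h1 hXα ht
  have ha' : 0 ≤ a + 7 * α ^ 2 := by positivity
  have hconv : ∀ t ∈ Icc (0 : ℝ) 1,
      (((((((L : ℝ) ^ k)⁻¹) ^ 2 / C) / 4 - (((((L : ℝ) ^ k)⁻¹) ^ 2 / C) / 2 + 16 * d) * θ) / 2 - 576 * d * (Real.exp α - 1) ^ 2)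
          / (Fintype.card n : ℝ) - 28 * d * (a + 7 * α ^ 2)) * D ≤ hess (vary Us X t) X X (plaqsOf (periodBox (d := d) (N * L ^ k))) :=
    fun t ht => hess_vary_ge_of_poincare hM hUs hXs hXP hα hXα hPX ht ha' (hrad t ht)
  -- left slop (F3) and right slop (§1 at the second configuration)
  have hleft := slop_of_tangent_critical hUs ha hUsa hsplit hXNs (perWin d (N * L ^ k)) (periodBox (d := d) (N * L ^ k)) (hcrit XT hXT) hN1
  have hU1 : IsUnitaryCfg (vary Us X 1) := AveragingDeficitPlaqDeriv.vary_isUnitaryCfg hUs hXs 1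
  have hright := (le_abs_self _).trans
    (abs_dAction_le_of_tangent_critical hU1 ha h1 hsplit' hXN's (perWin d (N * L ^ k)) (hcrit' XT' hXT') hN1')
  rw [e] at hleft hright
  have hD0 : D = 0 :=
    dirSq_eq_zero_of_two_slops Us X (plaqsOf (periodBox (d := d) (N * L ^ k))) hD hconv (by linarith) hright hline
  have h0 := eq_zero_of_dirSq_eq_zero hM hXP hD0
  refine ⟨h0, ?_⟩
  rw [h0]
  exact vary_zero_dir Us 1

end

end Summit.QuantumFields.BalabanUV.T4Continuum.NE7ConvOneStepCriticalUnique
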